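import Summits.AtomisticToContinuum.Crystallization.Theorems.PerronTransitivityNoFractionalGainStubMergeReduction
import Summits.AtomisticToContinuum.Crystallization.Theorems.PerronTransitivityNoFractionalGainStubCoreHeight
import Summits.AtomisticToContinuum.Crystallization.Theorems.PerronTransitivityNoFractionalGainStubTemplate
import Summits.AtomisticToContinuum.Crystallization.Theses.PerronTransitivity

/-!
# Crux `PerronTransitivity.NoFractionalGain` (stmt-AtomisticToContinuum-15098), line `merge-perron`:
# the SIZE of the open stub — an explicit-constant copositive bound is half of `Crystallization`

The one open stub of the line (skeleton rev. 3), `stub_copositiveKepler`, asserts for an e_LJ-optimal hcp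
scale `(a, h)`: `2·e_LJ(hcp a h)·∑cᵢ² ≤ ∑_{i≠j} cᵢcⱼV_LJ(dist xᵢ xⱼ)` for every `73/100`-separated finite
`x` and every `c ≥ 0`.  This file measures it exactly:

* `card_mul_le_interactionEnergy_of_copositiveBound` — if ANY level `E ≥ E*` bounds the copositive
  Lennard-Jones form on `73/100`-separated finite sets (`2E·∑cᵢ² ≤ ∑_{i≠j} cᵢcⱼV_ij`, `c ≥ 0`), then
  `N·E ≤ E_LJ(y)` for EVERY finite injective `y` (no separation): the general-level merge reduction
  `mergeReduction_of_coreHeight` at `δ = 73/100` removes close pairs, its core hypothesis `−2E ≤ V_LJ` on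
  `(0, 0.73]` following from `−2E ≤ −2E* ≤ V_LJ` (`stub_coreHeight`).
* `level_eq_iInf_of_copositiveBound` — hence `E ≤ E(N)/N → E*`, so `E = E*`: the only admissible explicit
  level is `E*` itself.
* `hasPeriodicGroundStateEnergy_of_copositiveBound` — if the level is `e_LJ(P)` for a periodic `P`, then `P`
  is a periodic Lennard-Jones ground state (`IsLeast`) and, with the tree's `crysEnergyLimit`
  (`E(N)/N → E*`), conjunct (i) `HasPeriodicGroundStateEnergy lennardJones 3` of `Crystallization` holds.
* `hasPeriodicGroundStateEnergy_of_copositiveKepler` — in particular `stub_copositiveKepler` (with the landed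
  `stub_template`) proves conjunct (i) of the summit's `Crystallization` outright, with minimiser the relaxed
  hcp crystal: the stub contains the periodic Lennard-Jones crystal problem (hcp-optimality AND attainment),
  Blanc–Lewin 2015 §2.3.  The crux K* itself (abstract `E*`) is not known to imply attainment; the explicit
  constant is what costs it.
* `copositiveKepler_iff_noFractionalGain_and_hcpLeast` — EXACTLY what the stub is:
  `stub_copositiveKepler ⇔ NoFractionalGain ∧ (an e_LJ-optimal hcp scale is a periodic Lennard-Jones ground
  state)`; i.e. the line `merge-perron` has reduced NOTHING of the crux except piles, and has ADDED the
  hcp periodic-minimiser problem (shared item `HcpPeriodicMinimiser`, stmt-AtomisticToContinuum-3061, up to its box).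
-/

noncomputable section

namespace Summit.AtomisticToContinuum.Crystallization.Theorems.PerronTransitivity.NoFractionalGain

open Literature.MathematicalPhysics.StatisticalMechanics
open Summit.AtomisticToContinuum.Crystallization.Theorems.ChargedEnergyGapNegative
  (bddBelow_energyPerParticle_lennardJones crysEnergyLimit)
open scoped BigOperators

/-- **An explicit-level copositive bound on `73/100`-separated sets bounds every finite energy.**  If
`E* ≤ E` and `2E·∑cᵢ² ≤ ∑_{i≠j} cᵢcⱼV_LJ(dist xᵢ xⱼ)` for every `73/100`-separated finite injective `x` and
every `c ≥ 0`, then `N·E ≤ E_LJ(y)` for every finite injective `y : Fin N → ℝ³` (merge reduction at level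
`E`, `δ = 73/100`, weights `c ≡ 1`). [folklore] -/
theorem card_mul_le_interactionEnergy_of_copositiveBound (E : ℝ)
    (hE : (⨅ Q : PeriodicConfiguration 3, Q.energyPerParticle lennardJones) ≤ E)
    (hcop : ∀ (N : ℕ) (x : Fin N → EuclideanSpace ℝ (Fin 3)), Function.Injective x →
      (∀ i j, i ≠ j → (73 : ℝ) / 100 ≤ dist (x i) (x j)) →
      ∀ c : Fin N → ℝ, (∀ i, 0 ≤ c i) →
        2 * E * ∑ i, c i ^ 2 ≤ ∑ i, ∑ j ∈ Finset.univ.erase i, c i * c j * lennardJones (dist (x i) (x j)))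
    {N : ℕ} (y : Fin N → EuclideanSpace ℝ (Fin 3)) (hy : Function.Injective y) :
    (N : ℝ) * E ≤ interactionEnergy lennardJones y := by
  have hcore : ∀ r : ℝ, 0 < r → r ≤ 73 / 100 → -2 * E ≤ lennardJones r := by
    intro r hr hr'
    have h := stub_coreHeight r hr hr'
    linarith
  obtain ⟨N', x', c', hx', hsep', hc', hF⟩ :=
    mergeReduction_of_coreHeight E (73 / 100) hcore y hy (fun _ => 1) fun _ => zero_le_one
  have h1 := hcop N' x' hx' hsep' c' hc'
  have h2 : ∑ i, ∑ j ∈ Finset.univ.erase i, (1 : ℝ) * 1 * lennardJones (dist (y i) (y j)) =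
      2 * interactionEnergy lennardJones y := by
    rw [two_mul_interactionEnergy]
    simp only [one_mul]
    rfl
  have h3 : ∑ _i : Fin N, (1 : ℝ) ^ 2 = N := by simp
  rw [h2, h3] at hF
  linarith

/-- Hence such a level is below every `E(N)/N`, `N ≥ 1`. [folklore] -/
theorem level_le_groundStateEnergy_div_of_copositiveBound (E : ℝ)
    (hE : (⨅ Q : PeriodicConfiguration 3, Q.energyPerParticle lennardJones) ≤ E)
    (hcop : ∀ (N : ℕ) (x : Fin N → EuclideanSpace ℝ (Fin 3)), Function.Injective x →
      (∀ i j, i ≠ j → (73 : ℝ) / 100 ≤ dist (x i) (x j)) →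
      ∀ c : Fin N → ℝ, (∀ i, 0 ≤ c i) →
        2 * E * ∑ i, c i ^ 2 ≤ ∑ i, ∑ j ∈ Finset.univ.erase i, c i * c j * lennardJones (dist (x i) (x j)))
    {N : ℕ} (hN : 0 < N) :
    E ≤ groundStateEnergy lennardJones 3 N / N := by
  have hNr : (0 : ℝ) < N := by exact_mod_cast hN
  rw [le_div_iff₀ hNr, mul_comm]
  haveI := nonempty_injective_config (by norm_num : 0 < 3) N
  exact le_ciInf fun x => card_mul_le_interactionEnergy_of_copositiveBound E hE hcop x.1 x.2

/-- **The only admissible explicit level is `E*`**: a level `E ≥ E*` bounding the copositive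
Lennard-Jones form on `73/100`-separated finite sets equals `E* = ⨅_Q e_LJ(Q)` (`E ≤ E(N)/N → E*`,
`crysEnergyLimit`). [folklore] -/
theorem level_eq_iInf_of_copositiveBound (E : ℝ)
    (hE : (⨅ Q : PeriodicConfiguration 3, Q.energyPerParticle lennardJones) ≤ E)
    (hcop : ∀ (N : ℕ) (x : Fin N → EuclideanSpace ℝ (Fin 3)), Function.Injective x →
      (∀ i j, i ≠ j → (73 : ℝ) / 100 ≤ dist (x i) (x j)) →
      ∀ c : Fin N → ℝ, (∀ i, 0 ≤ c i) →
        2 * E * ∑ i, c i ^ 2 ≤ ∑ i, ∑ j ∈ Finset.univ.erase i, c i * c j * lennardJones (dist (x i) (x j))) :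
    E = ⨅ Q : PeriodicConfiguration 3, Q.energyPerParticle lennardJones := by
  refine le_antisymm ?_ hE
  exact ge_of_tendsto crysEnergyLimit (Filter.eventually_atTop.2 ⟨1, fun N hN =>
    level_le_groundStateEnergy_div_of_copositiveBound E hE hcop hN⟩)

/-- **A periodic configuration whose doubled energy per particle bounds the copositive Lennard-Jones form on
`73/100`-separated finite sets is a periodic ground state, and conjunct (i) of `Crystallization` holds.**
[folklore] -/
theorem hasPeriodicGroundStateEnergy_of_copositiveBound (P : PeriodicConfiguration 3)
    (hcop : ∀ (N : ℕ) (x : Fin N → EuclideanSpace ℝ (Fin 3)), Function.Injective x →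
      (∀ i j, i ≠ j → (73 : ℝ) / 100 ≤ dist (x i) (x j)) →
      ∀ c : Fin N → ℝ, (∀ i, 0 ≤ c i) →
        2 * P.energyPerParticle lennardJones * ∑ i, c i ^ 2 ≤
          ∑ i, ∑ j ∈ Finset.univ.erase i, c i * c j * lennardJones (dist (x i) (x j))) :
    IsLeast (Set.range fun Q : PeriodicConfiguration 3 => Q.energyPerParticle lennardJones)
        (P.energyPerParticle lennardJones) ∧
      HasPeriodicGroundStateEnergy lennardJones 3 := by
  have hE : (⨅ Q : PeriodicConfiguration 3, Q.energyPerParticle lennardJones) ≤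
      P.energyPerParticle lennardJones := ciInf_le bddBelow_energyPerParticle_lennardJones P
  have heq := level_eq_iInf_of_copositiveBound _ hE hcop
  have hleast : IsLeast (Set.range fun Q : PeriodicConfiguration 3 => Q.energyPerParticle lennardJones)
      (P.energyPerParticle lennardJones) := by
    refine ⟨⟨P, rfl⟩, ?_⟩
    rintro v ⟨Q, rfl⟩
    rw [heq]
    exact ciInf_le bddBelow_energyPerParticle_lennardJones Q
  refine ⟨hleast, P, hleast, ?_⟩
  rw [heq]
  exact crysEnergyLimit

/-- **Size of the open stub `stub_copositiveKepler` of line `merge-perron`: it proves conjunct (i) of the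
summit's `Crystallization`.**  If for every e_LJ-optimal hcp scale `(a,h)` the copositive Lennard-Jones form
on `73/100`-separated finite sets is bounded by `2·e_LJ(hcp a h)·∑cᵢ²` (the registered stub, verbatim as
hypothesis), then — an optimal hcp scale existing by the landed `stub_template` — the relaxed hcp crystal is a
periodic Lennard-Jones ground state and `HasPeriodicGroundStateEnergy lennardJones 3` holds
(`E(N)/N → min_Q e_LJ(Q) = e_LJ(hcp a h)`).  So the stub contains the periodic Lennard-Jones crystal problem
with attainment (Blanc–Lewin 2015 §2.3, open). [folklore] -/
theorem hasPeriodicGroundStateEnergy_of_copositiveKepler :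
    (∀ (a h : ℝ) (ha : 0 < a) (hh : 0 < h),
      (∀ (a' h' : ℝ) (ha' : 0 < a') (hh' : 0 < h'),
        (hcpPeriodicConfiguration ha.ne' hh.ne').energyPerParticle lennardJones ≤
          (hcpPeriodicConfiguration ha'.ne' hh'.ne').energyPerParticle lennardJones) →
      ∀ (N : ℕ) (x : Fin N → EuclideanSpace ℝ (Fin 3)), Function.Injective x →
        (∀ i j, i ≠ j → (73 : ℝ) / 100 ≤ dist (x i) (x j)) →
        ∀ c : Fin N → ℝ, (∀ i, 0 ≤ c i) →
          2 * (hcpPeriodicConfiguration ha.ne' hh.ne').energyPerParticle lennardJones * ∑ i, c i ^ 2 ≤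
            ∑ i, ∑ j ∈ Finset.univ.erase i, c i * c j * lennardJones (dist (x i) (x j))) →
    HasPeriodicGroundStateEnergy lennardJones 3 := by
  intro hcop
  obtain ⟨a, h, ha, hh, hopt⟩ := stub_template
  exact (hasPeriodicGroundStateEnergy_of_copositiveBound (hcpPeriodicConfiguration ha.ne' hh.ne')
    (hcop a h ha hh hopt)).2

/-- Likewise the relaxed hcp crystal is then THE least-energy periodic configuration (hcp-optimality among
ALL periodic configurations of `ℝ³`, separated or not). [folklore] -/
theorem isLeast_hcp_of_copositiveKepler
    (hcop : ∀ (a h : ℝ) (ha : 0 < a) (hh : 0 < h),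
      (∀ (a' h' : ℝ) (ha' : 0 < a') (hh' : 0 < h'),
        (hcpPeriodicConfiguration ha.ne' hh.ne').energyPerParticle lennardJones ≤
          (hcpPeriodicConfiguration ha'.ne' hh'.ne').energyPerParticle lennardJones) →
      ∀ (N : ℕ) (x : Fin N → EuclideanSpace ℝ (Fin 3)), Function.Injective x →
        (∀ i j, i ≠ j → (73 : ℝ) / 100 ≤ dist (x i) (x j)) →
        ∀ c : Fin N → ℝ, (∀ i, 0 ≤ c i) →
          2 * (hcpPeriodicConfiguration ha.ne' hh.ne').energyPerParticle lennardJones * ∑ i, c i ^ 2 ≤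
            ∑ i, ∑ j ∈ Finset.univ.erase i, c i * c j * lennardJones (dist (x i) (x j)))
    (a h : ℝ) (ha : 0 < a) (hh : 0 < h)
    (hopt : ∀ (a' h' : ℝ) (ha' : 0 < a') (hh' : 0 < h'),
      (hcpPeriodicConfiguration ha.ne' hh.ne').energyPerParticle lennardJones ≤
        (hcpPeriodicConfiguration ha'.ne' hh'.ne').energyPerParticle lennardJones) :
    IsLeast (Set.range fun Q : PeriodicConfiguration 3 => Q.energyPerParticle lennardJones)
      ((hcpPeriodicConfiguration ha.ne' hh.ne').energyPerParticle lennardJones) :=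
  (hasPeriodicGroundStateEnergy_of_copositiveBound (hcpPeriodicConfiguration ha.ne' hh.ne')
    (hcop a h ha hh hopt)).1

/-- **What the open stub IS**: `stub_copositiveKepler` holds if and only if the crux `NoFractionalGain` holds
AND some e_LJ-optimal hcp scale is a least-energy periodic configuration.  (`⇒`: the line's composition —
`stub_mergeReduction` at `δ = 73/100` with `stub_coreHeight`, `E* ≤ e_LJ(hcp)` — and
`isLeast_hcp_of_copositiveKepler`; `⇐`: `IsLeast` identifies `E*` with `e_LJ(hcp a h)`, all optimal hcp
scales having the same energy, and K* is the bound verbatim, separation unused.) [folklore] -/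
theorem copositiveKepler_iff_noFractionalGain_and_hcpLeast :
    (∀ (a h : ℝ) (ha : 0 < a) (hh : 0 < h),
      (∀ (a' h' : ℝ) (ha' : 0 < a') (hh' : 0 < h'),
        (hcpPeriodicConfiguration ha.ne' hh.ne').energyPerParticle lennardJones ≤
          (hcpPeriodicConfiguration ha'.ne' hh'.ne').energyPerParticle lennardJones) →
      ∀ (N : ℕ) (x : Fin N → EuclideanSpace ℝ (Fin 3)), Function.Injective x →
        (∀ i j, i ≠ j → (73 : ℝ) / 100 ≤ dist (x i) (x j)) →
        ∀ c : Fin N → ℝ, (∀ i, 0 ≤ c i) →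
          2 * (hcpPeriodicConfiguration ha.ne' hh.ne').energyPerParticle lennardJones * ∑ i, c i ^ 2 ≤
            ∑ i, ∑ j ∈ Finset.univ.erase i, c i * c j * lennardJones (dist (x i) (x j))) ↔
    (Summit.AtomisticToContinuum.Crystallization.Theses.PerronTransitivity.NoFractionalGain ∧
      ∃ (a h : ℝ) (ha : 0 < a) (hh : 0 < h),
        (∀ (a' h' : ℝ) (ha' : 0 < a') (hh' : 0 < h'),
          (hcpPeriodicConfiguration ha.ne' hh.ne').energyPerParticle lennardJones ≤
            (hcpPeriodicConfiguration ha'.ne' hh'.ne').energyPerParticle lennardJones) ∧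
        IsLeast (Set.range fun Q : PeriodicConfiguration 3 => Q.energyPerParticle lennardJones)
          ((hcpPeriodicConfiguration ha.ne' hh.ne').energyPerParticle lennardJones)) := by
  constructor
  · intro hcop
    refine ⟨?_, ?_⟩
    · unfold Summit.AtomisticToContinuum.Crystallization.Theses.PerronTransitivity.NoFractionalGain
      intro N x hx c hc
      obtain ⟨a, h, ha, hh, hopt⟩ := stub_template
      obtain ⟨N', x', c', hx', hsep', hc', hF⟩ :=
        stub_mergeReduction (73 / 100) (by norm_num) stub_coreHeight N x hx c hc
      have h1 := hcop a h ha hh hopt N' x' hx' hsep' c' hc'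
      have h2 : (⨅ Q : PeriodicConfiguration 3, Q.energyPerParticle lennardJones) ≤
          (hcpPeriodicConfiguration ha.ne' hh.ne').energyPerParticle lennardJones :=
        ciInf_le bddBelow_energyPerParticle_lennardJones _
      have h3 : 0 ≤ ∑ i, c' i ^ 2 := Finset.sum_nonneg fun i _ => sq_nonneg (c' i)
      have h4 : 2 * (⨅ Q : PeriodicConfiguration 3, Q.energyPerParticle lennardJones) * ∑ i, c' i ^ 2 ≤
          2 * (hcpPeriodicConfiguration ha.ne' hh.ne').energyPerParticle lennardJones * ∑ i, c' i ^ 2 :=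
        mul_le_mul_of_nonneg_right (by linarith) h3
      linarith
    · obtain ⟨a, h, ha, hh, hopt⟩ := stub_template
      exact ⟨a, h, ha, hh, hopt, isLeast_hcp_of_copositiveKepler hcop a h ha hh hopt⟩
  · rintro ⟨hK, a₀, h₀, ha₀, hh₀, hopt₀, hleast⟩ a h ha hh hopt N x hx _ c hc
    have heq : (hcpPeriodicConfiguration ha.ne' hh.ne').energyPerParticle lennardJones =
        (hcpPeriodicConfiguration ha₀.ne' hh₀.ne').energyPerParticle lennardJones :=
      le_antisymm (hopt a₀ h₀ ha₀ hh₀) (hopt₀ a h ha hh)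
    have hinf : (⨅ Q : PeriodicConfiguration 3, Q.energyPerParticle lennardJones) =
        (hcpPeriodicConfiguration ha₀.ne' hh₀.ne').energyPerParticle lennardJones := hleast.csInf_eq
    have h1 := hK N x hx c hc
    rw [hinf, ← heq] at h1
    exact h1

end Summit.AtomisticToContinuum.Crystallization.Theorems.PerronTransitivity.NoFractionalGain

end
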